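import Mathlib.GroupTheory.Coset.Basic
import Mathlib.GroupTheory.GroupAction.Quotient
import Mathlib.Data.Set.Card
import Mathlib.Tactic.Group
import Mathlib.Algebra.BigOperators.Finprod
import Mathlib.SetTheory.Cardinal.Finite
import HarnessLib

/-!
# Unfolding the fixed points of `t ∈ H` on `G ⧸ K` over a double-coset decomposition `G = ⊔ᵢ H uᵢ K`:
# `Fix_t(G ⧸ K) ≃ Σᵢ Fix_t(H ⧸ H ∩ uᵢ K uᵢ⁻¹)`

Topic `NumberTheory/Automorphic`; namespace `Literature.NumberTheory.Automorphic.DoubleCosetFixedPoints`.  KERNEL mathematics only (pure group theory):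
theorems, no definition, no named fact, no instance, no notation, no `sorry`.  Cell `pub/hodgecm-mathlib`, programme P3a, road «D-N7-inert», MAP v3 «N7-ns
COUNT FROM FLICKER» brick (F2) «UNFOLDING» = [Flicker1998UnitaryFL, Prop. 5 p. 82] in the tree's fixed-point currency of ★ `OrbitalIntegralFixedPointCount`
(`Φ(t, 1_K) = #{q ∈ G ⧸ K : t • q = q}` at `vol K = 1`, torus mass one): Flicker's
«`∫_{G∕K} 1_K(x⁻¹tx) dx = Σ_{m ≥ 0} ∫_{H∕H^K_m} 1_{H^K_m}(h⁻¹th) dh`, `H^K_m = H ∩ u_m K u_m⁻¹`» for `t ∈ T ⊂ H` and `G = ⊔_m H u_m K` (his Prop. 4) IS,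
with counting measures on the discrete `G ∕ K` and `H ∕ H^K_m`, the bijection proved here (LEAD F0P3a-plan (g9) T8-41 deal (F2); architect A-p06 (g26);
(F1) = the decomposition, B-p17 (g24)).  HC_CM is proved only modulo the printed citations (2 remaining named inputs hLiu418, h413) until rung 0 closes; this
file discharges no named fact.

MATHEMATICS.  `G` a group, `H, K ≤ G`, `u : ι → G` with `G = ⋃ᵢ H uᵢ K` (`hA`) and the double cosets `H uᵢ K` pairwise distinct (`hB`); `Hᵢ := {h ∈ H : h ∈ uᵢ K uᵢ⁻¹}`
(a subgroup of `H`); `t ∈ H`.  The map `(i, h Hᵢ) ↦ h uᵢ K` is well defined and a BIJECTION `Σᵢ (H ⧸ Hᵢ) ≃ G ⧸ K` (§1) which is `H`-equivariant for the left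
actions; in particular it restricts to a bijection of `t`-FIXED POINTS **`{q ∈ G ⧸ K : t • q = q} ≃ Σᵢ {y ∈ H ⧸ Hᵢ : t • y = y}`** (§2), and
`t • (h Hᵢ) = h Hᵢ ↔ h⁻¹ t h ∈ uᵢ K uᵢ⁻¹` (`1_{H^K_m}(h⁻¹ t h)`, Flicker's integrand); hence, when the left side is finite,
**`#{q : t • q = q} = Σᶠᵢ #{y ∈ H ⧸ Hᵢ : t • y = y}`** (§3).

References: [Flicker1998UnitaryFL] Y. Z. Flicker, *Elementary proof of the fundamental lemma for a unitary group*, Canad. J. Math. 50 (1998), Prop. 4 pp. 80–81,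
Prop. 5 p. 82 · [Rogawski1990] J. D. Rogawski, *Automorphic Representations of Unitary Groups in Three Variables*, Ann. of Math. Stud. 123, §4.9 p. 54. -/

set_option autoImplicit false

namespace Literature.NumberTheory.Automorphic

namespace DoubleCosetFixedPoints

variable {G : Type*} [Group G] (H K : Subgroup G) {ι : Type*} (u : ι → G)

/-! ## §1 The bijection `Σᵢ H ⧸ Hᵢ ≃ G ⧸ K` -/

/-- Membership in `Hᵢ = H ∩ uᵢ K uᵢ⁻¹` read in `K`: for `h ∈ H`, `h ∈ uᵢ K uᵢ⁻¹ ↔ uᵢ⁻¹ h uᵢ ∈ K`. [cite: Flicker1998UnitaryFL, Prop. 4 p. 81] -/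
theorem mem_conjSubgroup_iff (i : ι) (h : ↥H) :
    h ∈ (K.map (MulAut.conj (u i)).toMonoidHom).subgroupOf H ↔ (u i)⁻¹ * (h : G) * u i ∈ K := by
  rw [Subgroup.mem_subgroupOf, Subgroup.mem_map_equiv]
  rfl

/-- `h uᵢ K = h′ uᵢ K ↔ h Hᵢ = h′ Hᵢ` (`h, h′ ∈ H`). [cite: Flicker1998UnitaryFL, Prop. 5 p. 82] -/
theorem mk_mul_eq_mk_mul_iff (i : ι) (h h' : ↥H) :
    (QuotientGroup.mk ((h : G) * u i) : G ⧸ K) = QuotientGroup.mk ((h' : G) * u i) ↔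
      (QuotientGroup.mk h : ↥H ⧸ (K.map (MulAut.conj (u i)).toMonoidHom).subgroupOf H) = QuotientGroup.mk h' := by
  rw [QuotientGroup.eq, QuotientGroup.eq, mem_conjSubgroup_iff, Subgroup.coe_mul, Subgroup.coe_inv]
  constructor <;> intro hk
  · have : (u i)⁻¹ * ((h : G)⁻¹ * (h' : G)) * u i = ((h : G) * u i)⁻¹ * ((h' : G) * u i) := by group
    rw [this]; exact hk
  · have : ((h : G) * u i)⁻¹ * ((h' : G) * u i) = (u i)⁻¹ * ((h : G)⁻¹ * (h' : G)) * u i := by group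
    rw [this]; exact hk

/-- **`t • (h Hᵢ) = h Hᵢ ↔ h⁻¹ t h ∈ uᵢ K uᵢ⁻¹`** (`↔ (h uᵢ)⁻¹ t (h uᵢ) ∈ K`) — Flicker's integrand `1_{H^K_m}(h⁻¹ t h)`.
[cite: Flicker1998UnitaryFL, Prop. 5 p. 82] -/
theorem smul_mk_eq_iff (i : ι) (t h : ↥H) :
    t • (QuotientGroup.mk h : ↥H ⧸ (K.map (MulAut.conj (u i)).toMonoidHom).subgroupOf H) = QuotientGroup.mk h ↔
      ((h : G) * u i)⁻¹ * (t : G) * ((h : G) * u i) ∈ K := by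
  rw [MulAction.Quotient.smul_mk, smul_eq_mul, eq_comm, QuotientGroup.eq, mem_conjSubgroup_iff, Subgroup.coe_mul, Subgroup.coe_inv, Subgroup.coe_mul]
  constructor <;> intro hk
  · have : ((h : G) * u i)⁻¹ * (t : G) * ((h : G) * u i) = (u i)⁻¹ * ((h : G)⁻¹ * ((t : G) * (h : G))) * u i := by group
    rw [this]; exact hk
  · have : (u i)⁻¹ * ((h : G)⁻¹ * ((t : G) * (h : G))) * u i = ((h : G) * u i)⁻¹ * (t : G) * ((h : G) * u i) := by group
    rw [this]; exact hk

/-- `t • (g K) = g K ↔ g⁻¹ t g ∈ K`. [cite: Rogawski1990, §4.9 p. 54] -/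
theorem smul_mk_eq_iff' (t g : G) : t • (QuotientGroup.mk g : G ⧸ K) = QuotientGroup.mk g ↔ g⁻¹ * t * g ∈ K := by
  rw [MulAction.Quotient.smul_mk, smul_eq_mul, eq_comm, QuotientGroup.eq, mul_assoc]

/-- **THE DOUBLE-COSET UNFOLDING OF `G ⧸ K`**: if `G = ⋃ᵢ H uᵢ K` with the `H uᵢ K` pairwise distinct, then `(i, h Hᵢ) ↦ h uᵢ K` is a bijection
`Σᵢ (H ⧸ Hᵢ) ≃ G ⧸ K`, `Hᵢ = H ∩ uᵢ K uᵢ⁻¹`, compatible with the left `H`-actions (`e (i, t • y) = t • e (i, y)`). [cite: Flicker1998UnitaryFL, Prop. 4 pp. 80–81; Prop. 5 p. 82] -/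
theorem exists_equiv_sigma_quotient
    (hA : ∀ g : G, ∃ i, ∃ h ∈ H, ∃ k ∈ K, g = h * u i * k)
    (hB : ∀ i j, ∀ h ∈ H, ∀ h' ∈ H, ∀ k ∈ K, ∀ k' ∈ K, h * u i * k = h' * u j * k' → i = j) :
    ∃ e : (Σ i, ↥H ⧸ (K.map (MulAut.conj (u i)).toMonoidHom).subgroupOf H) ≃ G ⧸ K,
      (∀ (i : ι) (h : ↥H), e ⟨i, QuotientGroup.mk h⟩ = QuotientGroup.mk ((h : G) * u i)) ∧
      ∀ (t : ↥H) (p : Σ i, ↥H ⧸ (K.map (MulAut.conj (u i)).toMonoidHom).subgroupOf H), e ⟨p.1, t • p.2⟩ = (t : G) • e p := by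
  classical
  -- the map on each summand, by `Quotient.lift`
  let f : ∀ i, ↥H ⧸ (K.map (MulAut.conj (u i)).toMonoidHom).subgroupOf H → G ⧸ K := fun i =>
    Quotient.lift (fun h : ↥H => (QuotientGroup.mk ((h : G) * u i) : G ⧸ K)) (by
      intro a b hab
      exact (mk_mul_eq_mk_mul_iff H K u i a b).2 (Quotient.sound hab))
  have hf : ∀ (i : ι) (h : ↥H), f i (QuotientGroup.mk h) = QuotientGroup.mk ((h : G) * u i) := fun _ _ => rfl
  let F : (Σ i, ↥H ⧸ (K.map (MulAut.conj (u i)).toMonoidHom).subgroupOf H) → G ⧸ K := fun p => f p.1 p.2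
  have hF : Function.Bijective F := by
    constructor
    · rintro ⟨i, y⟩ ⟨j, y'⟩ hyy
      induction y using QuotientGroup.induction_on with
      | H h =>
        induction y' using QuotientGroup.induction_on with
        | H h' =>
          change f i (QuotientGroup.mk h) = f j (QuotientGroup.mk h') at hyy
          rw [hf, hf, QuotientGroup.eq] at hyy
          -- `(h uᵢ)⁻¹ (h′ uⱼ) = k ∈ K` ⇒ `h′ uⱼ 1 = h uᵢ k` ⇒ `i = j`
          obtain rfl : i = j := by
            refine hB i j (h : G) h.2 (h' : G) h'.2 _ hyy 1 K.one_mem ?_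
            rw [mul_one, mul_inv_cancel_left]
          have h2 : (QuotientGroup.mk ((h : G) * u i) : G ⧸ K) = QuotientGroup.mk ((h' : G) * u i) := QuotientGroup.eq.2 hyy
          rw [Sigma.mk.inj_iff]
          exact ⟨rfl, heq_of_eq ((mk_mul_eq_mk_mul_iff H K u i h h').1 h2)⟩
    · intro q
      induction q using QuotientGroup.induction_on with
      | H g =>
        obtain ⟨i, h, hh, k, hk, hg⟩ := hA g
        refine ⟨⟨i, QuotientGroup.mk ⟨h, hh⟩⟩, ?_⟩
        change f i (QuotientGroup.mk ⟨h, hh⟩) = QuotientGroup.mk g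
        rw [hf, QuotientGroup.eq, hg]
        show (h * u i)⁻¹ * (h * u i * k) ∈ K
        rw [inv_mul_cancel_left]; exact hk
  refine ⟨Equiv.ofBijective F hF, fun i h => hf i h, fun t p => ?_⟩
  obtain ⟨i, y⟩ := p
  induction y using QuotientGroup.induction_on with
  | H h =>
    change f i (t • QuotientGroup.mk h) = (t : G) • f i (QuotientGroup.mk h)
    rw [MulAction.Quotient.smul_mk, smul_eq_mul, hf, hf, MulAction.Quotient.smul_mk, smul_eq_mul, Subgroup.coe_mul, mul_assoc]

/-! ## §2 Fixed points -/

/-- **FLICKER'S PROPOSITION 5 AS A BIJECTION OF FIXED POINTS**: for `t ∈ H`, `{q ∈ G ⧸ K : t • q = q} ≃ Σᵢ {y ∈ H ⧸ Hᵢ : t • y = y}`,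
`Hᵢ = H ∩ uᵢ K uᵢ⁻¹` — the set-theoretic content of «`∫_{G∕K} 1_K(x⁻¹tx) dx = Σ_m ∫_{H∕H^K_m} 1_{H^K_m}(h⁻¹th) dh`» with counting measures.
[cite: Flicker1998UnitaryFL, Prop. 5 p. 82] -/
theorem exists_equiv_fixedPoints_sigma
    (hA : ∀ g : G, ∃ i, ∃ h ∈ H, ∃ k ∈ K, g = h * u i * k)
    (hB : ∀ i j, ∀ h ∈ H, ∀ h' ∈ H, ∀ k ∈ K, ∀ k' ∈ K, h * u i * k = h' * u j * k' → i = j) {t : G} (ht : t ∈ H) :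
    Nonempty ({q : G ⧸ K // t • q = q} ≃
      Σ i, {y : ↥H ⧸ (K.map (MulAut.conj (u i)).toMonoidHom).subgroupOf H // (⟨t, ht⟩ : ↥H) • y = y}) := by
  obtain ⟨e, -, hsmul⟩ := exists_equiv_sigma_quotient H K u hA hB
  -- `e` restricted to fixed points, through the sigma-subtype shuffle
  let e₁ : {q : G ⧸ K // t • q = q} ≃ {p : Σ i, ↥H ⧸ (K.map (MulAut.conj (u i)).toMonoidHom).subgroupOf H // (⟨t, ht⟩ : ↥H) • p.2 = p.2} :=
    { toFun := fun q => ⟨e.symm q.1, by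
        have h1 : e ⟨(e.symm q.1).1, (⟨t, ht⟩ : ↥H) • (e.symm q.1).2⟩ = e (e.symm q.1) := by
          rw [hsmul, Equiv.apply_symm_apply]; exact q.2
        have h2 : (⟨(e.symm q.1).1, (⟨t, ht⟩ : ↥H) • (e.symm q.1).2⟩ :
            Σ i, ↥H ⧸ (K.map (MulAut.conj (u i)).toMonoidHom).subgroupOf H) = ⟨(e.symm q.1).1, (e.symm q.1).2⟩ :=
          (e.injective h1).trans (Sigma.eta _).symm
        exact eq_of_heq (Sigma.mk.inj_iff.1 h2).2⟩
      invFun := fun p => ⟨e p.1, by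
        have h1 := hsmul ⟨t, ht⟩ p.1
        rw [p.2] at h1
        exact h1.symm⟩
      left_inv := fun q => Subtype.ext (e.apply_symm_apply q.1)
      right_inv := fun p => Subtype.ext (e.symm_apply_apply p.1) }
  let e₂ : {p : Σ i, ↥H ⧸ (K.map (MulAut.conj (u i)).toMonoidHom).subgroupOf H // (⟨t, ht⟩ : ↥H) • p.2 = p.2} ≃
      Σ i, {y : ↥H ⧸ (K.map (MulAut.conj (u i)).toMonoidHom).subgroupOf H // (⟨t, ht⟩ : ↥H) • y = y} :=
    { toFun := fun p => ⟨p.1.1, ⟨p.1.2, p.2⟩⟩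
      invFun := fun q => ⟨⟨q.1, q.2.1⟩, q.2.2⟩
      left_inv := fun _ => rfl
      right_inv := fun _ => rfl }
  exact ⟨e₁.trans e₂⟩

/-! ## §3 Counting -/

/-- `#(Σᵢ βᵢ) = Σᶠᵢ #βᵢ` for a FINITE sigma type (then every fibre is finite and only finitely many are nonempty). [folklore] -/
private theorem natCard_sigma_eq_finsum {α : Type*} (β : α → Type*) [Finite (Σ i, β i)] :
    Nat.card (Σ i, β i) = ∑ᶠ i, Nat.card (β i) := by
  classical
  have hs : (Set.range (Sigma.fst : (Σ i, β i) → α)).Finite := Set.finite_range _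
  haveI : ∀ i, Finite (β i) := fun i => Finite.of_injective (fun b : β i => (⟨i, b⟩ : Σ i, β i)) sigma_mk_injective
  haveI : Fintype {i // i ∈ Set.range (Sigma.fst : (Σ i, β i) → α)} := hs.fintype
  have e : (Σ i : {i // i ∈ Set.range (Sigma.fst : (Σ i, β i) → α)}, β i) ≃ Σ i, β i :=
    Equiv.sigmaSubtypeEquivOfSubset β _ (fun i b => ⟨⟨i, b⟩, rfl⟩)
  have hsupp : Function.support (fun i => Nat.card (β i)) ⊆ Set.range (Sigma.fst : (Σ i, β i) → α) := by
    intro i hi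
    obtain ⟨⟨b⟩, -⟩ := Nat.card_ne_zero.1 hi
    exact ⟨⟨i, b⟩, rfl⟩
  rw [← Nat.card_congr e, Nat.card_sigma, finsum_eq_sum_of_support_subset_of_finite _ hsupp hs]
  exact (Finset.sum_subtype hs.toFinset (fun _ => hs.mem_toFinset) fun i => Nat.card (β i)).symm

/-- **FLICKER'S PROPOSITION 5, COUNTED**: for `t ∈ H` with finitely many fixed points on `G ⧸ K` (e.g. `t` regular, [Flicker1998UnitaryFL] p. 82),
`#{q ∈ G ⧸ K : t • q = q} = Σᶠᵢ #{y ∈ H ⧸ Hᵢ : t • y = y}`, `Hᵢ = H ∩ uᵢ K uᵢ⁻¹` — with ★ `orbitalIntegral_indicator_quotientMeasure_eq_natCard_fixedPoints`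
(`vol K = 1`, torus mass one) this is «`∫_{G∕K} 1_K(x⁻¹tx) dx = Σ_m ∫_{H∕H^K_m} 1_{H^K_m}(h⁻¹th) dh`». [cite: Flicker1998UnitaryFL, Prop. 5 p. 82] -/
theorem natCard_fixedPoints_eq_finsum
    (hA : ∀ g : G, ∃ i, ∃ h ∈ H, ∃ k ∈ K, g = h * u i * k)
    (hB : ∀ i j, ∀ h ∈ H, ∀ h' ∈ H, ∀ k ∈ K, ∀ k' ∈ K, h * u i * k = h' * u j * k' → i = j) {t : G} (ht : t ∈ H)
    (hfin : {q : G ⧸ K | t • q = q}.Finite) :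
    Nat.card {q : G ⧸ K | t • q = q} =
      ∑ᶠ i, Nat.card {y : ↥H ⧸ (K.map (MulAut.conj (u i)).toMonoidHom).subgroupOf H | (⟨t, ht⟩ : ↥H) • y = y} := by
  obtain ⟨e⟩ := exists_equiv_fixedPoints_sigma H K u hA hB ht
  haveI : Finite {q : G ⧸ K // t • q = q} := hfin.to_subtype
  haveI : Finite (Σ i, {y : ↥H ⧸ (K.map (MulAut.conj (u i)).toMonoidHom).subgroupOf H // (⟨t, ht⟩ : ↥H) • y = y}) :=
    Finite.of_equiv _ e
  exact (Nat.card_congr e).trans (natCard_sigma_eq_finsum _)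

/-- Only finitely many double cosets carry a `t`-fixed point, and each carries finitely many, when `{q ∈ G ⧸ K : t • q = q}` is finite.
[cite: Flicker1998UnitaryFL, Prop. 5 p. 82] -/
theorem finite_setOf_nonempty_fixedPoints
    (hA : ∀ g : G, ∃ i, ∃ h ∈ H, ∃ k ∈ K, g = h * u i * k)
    (hB : ∀ i j, ∀ h ∈ H, ∀ h' ∈ H, ∀ k ∈ K, ∀ k' ∈ K, h * u i * k = h' * u j * k' → i = j) {t : G} (ht : t ∈ H)
    (hfin : {q : G ⧸ K | t • q = q}.Finite) :
    {i | Nonempty {y : ↥H ⧸ (K.map (MulAut.conj (u i)).toMonoidHom).subgroupOf H // (⟨t, ht⟩ : ↥H) • y = y}}.Finite ∧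
      ∀ i, Finite {y : ↥H ⧸ (K.map (MulAut.conj (u i)).toMonoidHom).subgroupOf H // (⟨t, ht⟩ : ↥H) • y = y} := by
  obtain ⟨e⟩ := exists_equiv_fixedPoints_sigma H K u hA hB ht
  haveI : Finite {q : G ⧸ K // t • q = q} := hfin.to_subtype
  haveI hSig : Finite (Σ i, {y : ↥H ⧸ (K.map (MulAut.conj (u i)).toMonoidHom).subgroupOf H // (⟨t, ht⟩ : ↥H) • y = y}) :=
    Finite.of_equiv _ e
  refine ⟨?_, fun i => @Finite.of_injective _ _ hSig (fun y : {y : ↥H ⧸ (K.map (MulAut.conj (u i)).toMonoidHom).subgroupOf H // (⟨t, ht⟩ : ↥H) • y = y} =>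
    (⟨i, y⟩ : Σ i, {y : ↥H ⧸ (K.map (MulAut.conj (u i)).toMonoidHom).subgroupOf H // (⟨t, ht⟩ : ↥H) • y = y})) fun a b hab => eq_of_heq (Sigma.mk.inj_iff.1 hab).2⟩
  refine (Set.finite_range (Sigma.fst :
    (Σ i, {y : ↥H ⧸ (K.map (MulAut.conj (u i)).toMonoidHom).subgroupOf H // (⟨t, ht⟩ : ↥H) • y = y}) → ι)).subset ?_
  rintro i ⟨y⟩
  exact ⟨⟨i, y⟩, rfl⟩

end DoubleCosetFixedPoints

end Literature.NumberTheory.Automorphic
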